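import Literature.MathematicalPhysics.QuantumFieldTheory.Balaban1983to89.B6BoxChartsCorners

/-!
# `Balaban1983to89.B6BoxChartsCubeUnions` — [Balaban1984PropagatorsII] Sect. A p. 231 (2.46) with (2.66) p. 234 and
Prop. 2.6 p. 247: the two-scale model of `…Balaban1983to89.B6BoxCharts` §8 over an ARBITRARY UNION Λ OF CUBES of the
M-partition of the η-lattice — a second LEAF of that file (cell pub-balaban, lineage pv08; the parent v1.4 and the
first leaf `…B6BoxChartsCorners` v1 are IMPORTED, NOT modified: the parent, 155 624 bytes, would pass the gate's cap of
200 000 bytes per file with the first leaf's §10 (54 853 bytes) appended, and this §11 needs §10 — its generic region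
model `regionGraph` (§10a), corner instances (§10c–e) and window-sum lemma `sum266_le_of_cmp` (§10f) are used BY NAME).
The parent's flat model (§8: Ω₁ a half-space) and the first leaf's corner models (§10: Ω₁ an orthant or a union of
half-spaces in the directions I) are the instances Λ = {0 ≤ x_μ}, Λ = ⋂_{i∈I}{0 ≤ x_i}, Λ = ⋃_{i∈I}{0 ≤ x_i} of ONE model
`cuGraph d L M Λ` in which the coarse domain Λ ⊆ ℤ^d is ANY union of cubes of the partition of ℤ^d into blocks of side
M (`IsCubeUnion M Λ`; p. 231: the domain Ω_j is a sum of cubes of the size of the big blocks — quoted in the parent):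
fine η-bonds within sup-distance M of the complement of Λ, coarse Lη-bonds {L·y, L·y′} with both ends in Λ.  PROVED: for
1 ≤ L ≤ M and EVERY such Λ — any number of salient and re-entrant corners, edges, staircases, several components of
either region, bounded or unbounded — any two points of the model are joined by an admissible walk and
`dist u v ≤ ‖u − v‖₁ + 4d(L − 1)` (η-units); hence the (2.66)-shaped transfer with the factor e^{δ·4d(L−1)} and the last
«≤» of (2.66) with the constant e^{½δ₀·4d(L−1)}·c₀(δ₀, ½)^d — depending on d, L, δ₀ only, UNIFORM IN M AND IN Λ.  The
additive constant cannot be taken below d(L − 1) (the re-entrant corner of the first leaf with I = all d directions is an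
instance); the sharp uniform constant K*(d, L) ∈ [d(L − 1), 4d(L − 1)] is not determined here.

CITATION HEADER (lean-in-tree rule 2026-08-18).  Source: T. Bałaban, *Propagators and renormalization transformations for
lattice gauge theories. II*, Commun. Math. Phys. **96**, 223–250 (1984), doi:10.1007/bf01240221 (cell paper B6; held:
`paper:balaban1984-cmp96-propagators-rt-ii`; journal page = PDF page + 222).  NO NEW QUOTATION: the printed inputs this
leaf bears on are quoted verbatim, with page references and render file names, in the parent `…B6BoxCharts` — p. 223
[PDF 1] (the ℓ¹ distance), (2.2)–(2.4) p. 224 [2] (the sequence of domains and the big blocks), p. 229 [7] (the big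
blocks of the size ML^jη, or of the size M if Λ_j is scaled to the unit lattice — docstring of the parent's §9),
Sect. A p. 231 [9] ((2.46) and the sentence on Ω_j as a sum of cubes, header of the parent; re-read for this leaf from
the render `b2b-balaban-ref1/pages/1984-cmp96-propagators-rt-II/1984-cmp96-propagators-rt-II-p009-x2.png`), (2.66) p. 234 [12] (header of the
parent) and Prop. 2.6 p. 247 [25] (docstring of the parent's §9; quoted again in the header of the first leaf).  The
lattice ℤ^d = `Site d`, its nearest-neighbour graph `zdGraph d`, `supDist`, `latL1Dist`, `exists_step_towards`
(`Literature.Probability.LatticeModels.…`), the parent's box charts (`CboxClosed`, `cboxClosed_Icc`, `IsBoxChart`,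
`reachable_of_chart`, `dist_le_latL1Dist_of_chart`, `dist_le_one_of_eq_or_adj`), its block partition (`blockAtlas`,
`mem_blockBox_iff`, `blockIdx`, `mem_blockBox_blockIdx`, `blockIdx_eq_of_mem`), its two-scale vocabulary (`scalePt`,
`twoScaleGraph/Pts`, `latL1Dist_scalePt`, `exp_decay_transfer`) and the first leaf's region model and corner instances
(`regionGraph/Pts`, `regionGraph_adj_of_coarse`, `isBoxChart_region_fine`, `salient*`, `reentrant*`,
`reentrant_dist_cornerWitness`, `sum266_le_of_cmp`) are used BY NAME; nothing upstream is modified.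

THE DICTIONARY (the parent's and the first leaf's, continued).  Scale Λ_j to the unit lattice: the η-lattice is ℤ^d, the
big blocks of (2.3)–(2.4) are the cubes Icc (M·a) (M·a + (M − 1)·𝟙), a ∈ ℤ^d, of the block partition `blockAtlas d M` of
the parent's §7, and the coarse domain Ω_j ↦ Λ ⊆ ℤ^d, a union of such cubes: `IsCubeUnion M Λ` (every cube of the
partition meeting Λ lies in Λ; `IsCubeUnion.eq_biUnion`: Λ is the union of the cubes it contains).  The lattice points of
T near and inside Λ: the η-points of the FINE region `cuFine M Λ` = {x : ∃ w ∉ Λ, ‖x − w‖_∞ ≤ M} (the complement of Λ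
thickened INTO Λ by the width M of one block: the overlap slab of the parent's §8, whose fine region {x_μ < M} is
`cuFine M {0 ≤ x_μ}` — `cuFine_halfspace`) joined by η-bonds, and the Lη-points L·y, y ∈ `cuCoarse L Λ` = {y : L·y ∈ Λ},
joined by the Lη-bonds {L·y, L·y′}, y ∼ y′ (the parent's coarse half-lattice {0 ≤ y_μ} is `cuCoarse L {0 ≤ x_μ}`, L ≥ 1 —
`cuCoarse_halfspace`); the two bond families are glued through the common points L·y ∈ `cuFine` (shared-point linkage,
parent §3).  `cuGraph d L M Λ := regionGraph d L (cuFine M Λ) (cuCoarse L Λ)`; the flat model `twoScaleGraph d L M μ`,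
the salient corner `salientGraph d L M I` and the re-entrant corner `reentrantGraph d L M I` are the cases
Λ = {0 ≤ x_μ}, Λ = `salientCoarse d I`, Λ = `reentrantCoarse d I` (`cuGraph_halfspace`, `cuGraph_salient`,
`cuGraph_reentrant`: equalities of graphs, L ≥ 1).  `dist` = the graph distance = the number of bonds of a shortest
admissible contour, every bond counted at the weight of its own lattice, as in the parent's §§8e, 9 and the first leaf.

PROVED [folklore model computations; every `theorem` below, no `sorry`, no new axiom].
1. §11a: `IsCubeUnion M` is closed under complement, ∩, ∪, ⋂, ⋃; the cubes of the partition and their unions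
   (`isCubeUnion_blockBox`, `isCubeUnion_biUnion`; M ≥ 1), the half-spaces {0 ≤ x_μ} (`isCubeUnion_halfspace`), the
   orthant `salientCoarse d I` and the union of half-spaces `reentrantCoarse d I` (any M) are cube unions; conversely a
   cube union is the union of the cubes it contains (`IsCubeUnion.eq_biUnion`, M ≥ 1).
2. §11b: the model `cuFine / cuCoarse / cuGraph / cuPts` and the three instance identities above (with their point sets
   `cuPts_halfspace`, `cuPts_salient`, `cuPts_reentrant`); `scalePt_mem_cuPts`: every Lη-point is a point of the model.
3. §11c, THE COARSE SKELETON: `cu_coarseStep` — for 1 ≤ L ≤ M, consecutive Lη-points L·z, L·(z + e_i) are joined at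
   distance ≤ L for EVERY Λ (a coarse bond when both lie in Λ; otherwise the η-segment between them, L + 1 points within
   sup-distance L ≤ M of the end outside Λ, is a fine chart `Icc_subset_cuFine`); `cu_coarseLattice`:
   d(L·z, L·z′) ≤ L·‖z − z′‖₁ = ‖L·z − L·z′‖₁ for all z, z′ ∈ ℤ^d (induction along `exists_step_towards`).
4. §11d, THE ANCHOR (`exists_anchor`, the one place where `IsCubeUnion` is used): a fine point u, within sup-distance M
   of some w ∉ Λ, lies together with the whole cube Q ∌ w of the partition (Q ∩ Λ = ∅ by `IsCubeUnion`) in the order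
   box H = hull(u, Q), and H ⊆ `cuFine` (every point of H is within sup-distance M of its clamp into Q); H is a fine
   chart of side ≥ M ≥ L containing u, so rounding each coordinate of u inside H to a multiple of L gives an Lη-point
   L·z ∈ H with |u_i − L·z_i| ≤ L − 1 for every i, whence d(u, L·z) ≤ ‖u − L·z‖₁ ≤ d(L − 1).
5. §11e, THE COMPARISON: `cu_fine_coarse` (d(u, L·y) ≤ ‖u − L·y‖₁ + 2d(L − 1): anchor, then the coarse skeleton),
   `cu_fine_fine` (+ 4d(L − 1): two anchors) and **`cu_reachable_dist`**: for 1 ≤ L ≤ M, Λ any cube union and all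
   u, v ∈ `cuPts d L M Λ`, u, v are joined and `dist u v ≤ ‖u − v‖₁ + 4·(d·(L − 1))` — input (α) and the comparison of
   §8e item 8 / §10 with an additive constant depending on d and L only, for all Ω at once.
6. §11f: `cu_exp_decay_le` (e^{−δ‖u − v‖₁} ≤ e^{δ·4d(L−1)}·e^{−δ·dist(u,v)}, δ ≥ 0) and **`cu_sum266_le`**, the last «≤»
   of (2.66) in the model: Σ_{y″∈S} e^{−δ₀‖y − y″‖₁}·e^{−½δ₀d(y″,y′)} ≤ e^{½δ₀·4d(L−1)}·c₀(δ₀, ½)^d·e^{−½δ₀d(y,y′)}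
   (δ₀ > 0; y ∈ T, finite S ⊆ T) — the constant depends on d, L, δ₀ only: UNIFORM IN M (the dependence p. 247 prints for
   the O(1) of Prop. 2.6) AND IN THE DOMAIN Λ.
7. §11g, LOWER BOUND: `cu_constant_attained` / `cu_constant_lower` — for M = L·M′ (M′ ≥ 1, L ≥ 1, d ≥ 1) the cube union
   Λ = `reentrantCoarse d univ` has two model points at distance exactly ‖u − v‖₁ + d(L − 1) (the first leaf's
   `reentrant_dist_cornerWitness` through `cuGraph_reentrant`), so no additive constant below d(L − 1) is uniform in Λ.

WHAT IS NOT PROVED / NOT CLAIMED.  Nothing printed is asserted; (2.46), (2.66), Prop. 2.2 / 2.6 and everything analytic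
remain hypotheses of the siblings, and (2.2) p. 224 is not used (the model statement holds for every cube union).  These
are computations in a model with ONE interface between TWO lattice scales on the INFINITE lattice ℤ^d: they decide the
«Ω_j an arbitrary union of big cubes: several corners of both kinds, routes between them» entry of the located list
(header of `…B6BoxCharts`, WHAT IS NOT PROVED; header of `…B6BoxChartsCorners`; GAPS.md G-pv08-1) in that setting only —
the comparison behind (2.66) holds with the adjacent-scale constant and an additive constant between d(L − 1) and
4d(L − 1), and the last «≤» of (2.66) with a constant depending on d, L, δ₀ only; the SHARP uniform constant is not
determined (4d(L − 1) is what the two-anchor route gives; d(L − 1) is attained).  THREE levels j − 1, j, j + 1 at once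
and k > 1 (the flat k-level tower is the sibling `…B6LevelTower`), the torus identification, the cover 𝒟 of p. 229 and
WHICH boxes are charts of Bałaban's admissible class remain LOCATED exactly as the parent states them.  VALUE:
bookkeeping — a kernel certificate that the shape of Ω_j costs at most a d, L-dependent additive constant in the
two-scale model, uniformly in the domain; NOT progress on any disputed estimate.
-/

namespace Literature.MathematicalPhysics.QuantumFieldTheory.Balaban1983to89.B6BoxChartsCubeUnions

open Literature.Probability.LatticeModels
open B6Geometry B6LevelGapMetric B6BoxCharts B6BoxChartsCorners

/-! ## 11. The two-scale model over an ARBITRARY UNION OF CUBES Λ of the M-partition [folklore model computations;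
nothing printed is asserted] — numbered §11 to continue the parent's §§1–9 and the first leaf's §10 -/

section CubeUnion

variable {d : ℕ}

/-! ### 11a. Unions of cubes of the block partition of side M [folklore; p. 231 names the object] -/

/-- Λ ⊆ ℤ^d is a UNION OF CUBES of the partition of ℤ^d into the blocks Icc (M·a) (M·a + (M − 1)·𝟙), a ∈ ℤ^d, of side M
(`blockAtlas d M` of the parent's §7): every block of the partition that meets Λ lies in Λ.  The coarse domain Ω_j of
p. 231, scaled to the unit lattice, with M the side of a big block. [folklore] -/
def IsCubeUnion (M : ℕ) (Λ : Set (Site d)) : Prop :=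
  ∀ ⦃a x : Site d⦄, x ∈ (blockAtlas d M).box a → x ∈ Λ → (blockAtlas d M).box a ⊆ Λ

variable {M : ℕ} {Λ Λ₁ Λ₂ : Set (Site d)}

/-- The complement of a cube union is a cube union (a block meeting Λᶜ cannot meet Λ). [folklore] -/
theorem IsCubeUnion.compl (h : IsCubeUnion M Λ) : IsCubeUnion M Λᶜ :=
  fun _ _ hx hxΛ _ hz hzΛ => hxΛ (h hz hzΛ hx)

/-- Intersections of cube unions are cube unions. [folklore] -/
theorem IsCubeUnion.inter (h₁ : IsCubeUnion M Λ₁) (h₂ : IsCubeUnion M Λ₂) : IsCubeUnion M (Λ₁ ∩ Λ₂) :=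
  fun _ _ hx hxΛ => Set.subset_inter (h₁ hx hxΛ.1) (h₂ hx hxΛ.2)

/-- Unions of cube unions are cube unions. [folklore] -/
theorem IsCubeUnion.union (h₁ : IsCubeUnion M Λ₁) (h₂ : IsCubeUnion M Λ₂) : IsCubeUnion M (Λ₁ ∪ Λ₂) := by
  intro a x hx hxΛ
  rcases hxΛ with h | h
  · exact (h₁ hx h).trans Set.subset_union_left
  · exact (h₂ hx h).trans Set.subset_union_right

/-- Arbitrary intersections of cube unions are cube unions. [folklore] -/
theorem IsCubeUnion.iInter {ι : Sort*} {Λ : ι → Set (Site d)} (h : ∀ k, IsCubeUnion M (Λ k)) :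
    IsCubeUnion M (⋂ k, Λ k) :=
  fun _ _ hx hxΛ => Set.subset_iInter fun k => h k hx (Set.mem_iInter.1 hxΛ k)

/-- Arbitrary unions of cube unions are cube unions. [folklore] -/
theorem IsCubeUnion.iUnion {ι : Sort*} {Λ : ι → Set (Site d)} (h : ∀ k, IsCubeUnion M (Λ k)) :
    IsCubeUnion M (⋃ k, Λ k) := by
  intro a x hx hxΛ
  obtain ⟨k, hk⟩ := Set.mem_iUnion.1 hxΛ
  exact (h k hx hk).trans (Set.subset_iUnion Λ k)

/-- The whole lattice is a cube union. [folklore] -/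
theorem isCubeUnion_univ : IsCubeUnion M (Set.univ : Set (Site d)) := fun _ _ _ _ => Set.subset_univ _

/-- The empty set is a cube union. [folklore] -/
theorem isCubeUnion_empty : IsCubeUnion M (∅ : Set (Site d)) := fun _ _ _ h => absurd h (Set.notMem_empty _)

/-- A block of the partition is a cube union (M ≥ 1: the blocks partition ℤ^d, `blockIdx_eq_of_mem`). [folklore] -/
theorem isCubeUnion_blockBox (hM : 0 < M) (a : Site d) : IsCubeUnion M ((blockAtlas d M).box a) := by
  intro a' x hx hxa
  rw [← blockIdx_eq_of_mem hM hx, blockIdx_eq_of_mem hM hxa]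

/-- Any union of blocks of the partition is a cube union (M ≥ 1). [folklore] -/
theorem isCubeUnion_biUnion (hM : 0 < M) (A : Set (Site d)) : IsCubeUnion M (⋃ a ∈ A, (blockAtlas d M).box a) :=
  IsCubeUnion.iUnion fun a => IsCubeUnion.iUnion fun _ => isCubeUnion_blockBox hM a

/-- Conversely, a cube union IS the union of the blocks of the partition it contains (M ≥ 1: the blocks cover ℤ^d,
`mem_blockBox_blockIdx`) — so `IsCubeUnion M Λ` says precisely that Λ is a union of cubes of the partition. [folklore] -/
theorem IsCubeUnion.eq_biUnion (hM : 0 < M) (h : IsCubeUnion M Λ) :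
    Λ = ⋃ a ∈ {a : Site d | (blockAtlas d M).box a ⊆ Λ}, (blockAtlas d M).box a := by
  refine Set.ext fun x => ?_
  rw [Set.mem_iUnion₂]
  constructor
  · intro hx
    exact ⟨blockIdx M x, h (mem_blockBox_blockIdx hM x) hx, mem_blockBox_blockIdx hM x⟩
  · rintro ⟨a, ha, hxa⟩
    exact ha hxa

/-- A coordinate half-space {0 ≤ x_μ} (the coarse side Ω₁ of the parent's flat model) is a cube union: a block meeting it
has M·a_μ + M − 1 ≥ 0, so a_μ ≥ 0 and the whole block has x_μ ≥ M·a_μ ≥ 0 (any M). [folklore] -/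
theorem isCubeUnion_halfspace (M : ℕ) (μ : Fin d) : IsCubeUnion M {x : Site d | 0 ≤ x μ} := by
  intro a x hx hx0 z hz
  have hx0' : 0 ≤ x μ := hx0
  obtain ⟨-, h2⟩ := mem_blockBox_iff.1 hx μ
  obtain ⟨h3, -⟩ := mem_blockBox_iff.1 hz μ
  show 0 ≤ z μ
  have h4 : 0 < (M : ℤ) * (a μ + 1) := by rw [mul_add, mul_one]; omega
  have h5 : 0 < a μ + 1 := pos_of_mul_pos_right h4 (Int.natCast_nonneg M)
  have h6 : 0 ≤ (M : ℤ) * a μ := Int.mul_nonneg (Int.natCast_nonneg M) (by omega)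
  omega

/-- The orthant ⋂_{i∈I}{0 ≤ x_i} (the coarse side of the first leaf's SALIENT corner) is a cube union. [folklore] -/
theorem isCubeUnion_salientCoarse (M : ℕ) (I : Finset (Fin d)) : IsCubeUnion M (salientCoarse d I) :=
  fun _ _ hx hxS _ hz i hi => isCubeUnion_halfspace M i hx (hxS i hi) hz

/-- The union of half-spaces ⋃_{i∈I}{0 ≤ x_i} (the coarse side of the first leaf's RE-ENTRANT corner) is a cube union.
[folklore] -/
theorem isCubeUnion_reentrantCoarse (M : ℕ) (I : Finset (Fin d)) : IsCubeUnion M (reentrantCoarse d I) := by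
  intro a x hx hxS z hz
  obtain ⟨i, hi, hx0⟩ := hxS
  exact ⟨i, hi, isCubeUnion_halfspace M i hx hx0 hz⟩

/-! ### 11b. The two-scale model over Λ: fine bonds near the complement of Λ, coarse bonds inside Λ [folklore] -/

/-- FINE region of the model over Λ: the η-lattice points within sup-distance M of the complement of Λ — the region
outside Ω together with the overlap slab of width M (one block) inside Ω along its boundary, as in the parent's §8
(`cuFine_halfspace`). [folklore] -/
def cuFine (M : ℕ) (Λ : Set (Site d)) : Set (Site d) := {x | ∃ w, w ∉ Λ ∧ supDist x w ≤ M}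

/-- COARSE region of the model over Λ: the coarse indices y whose Lη-lattice point L·y lies in Λ. [folklore] -/
def cuCoarse (L : ℕ) (Λ : Set (Site d)) : Set (Site d) := {y | scalePt L y ∈ Λ}

/-- The two-scale bond graph over the coarse domain Λ: η-bonds with both ends in `cuFine M Λ`, Lη-bonds {L·y, L·y′},
y ∼ y′, with both ends in Λ (the first leaf's `regionGraph`). [folklore] -/
def cuGraph (d L M : ℕ) (Λ : Set (Site d)) : SimpleGraph (Site d) := regionGraph d L (cuFine M Λ) (cuCoarse L Λ)

/-- Its point set T: `cuFine M Λ` ∪ L·`cuCoarse L Λ`. [folklore] -/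
def cuPts (d L M : ℕ) (Λ : Set (Site d)) : Set (Site d) := regionPts d L (cuFine M Λ) (cuCoarse L Λ)

/-- The complement of Λ lies in the fine region. [folklore] -/
theorem compl_subset_cuFine (M : ℕ) (Λ : Set (Site d)) : Λᶜ ⊆ cuFine M Λ :=
  fun x hx => ⟨x, hx, by rw [supDist_self]; exact Nat.zero_le _⟩

/-- Every Lη-lattice point is a point of the model: coarse if it lies in Λ, fine (indeed in Λᶜ) otherwise. [folklore] -/
theorem scalePt_mem_cuPts (L M : ℕ) (Λ : Set (Site d)) (z : Site d) : scalePt L z ∈ cuPts d L M Λ := by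
  by_cases h : scalePt L z ∈ Λ
  · exact Or.inr ⟨z, h, rfl⟩
  · exact Or.inl (compl_subset_cuFine M Λ h)

/-- HONESTY: points outside T are isolated (the first leaf's `regionGraph_not_adj_of_not_mem`). [folklore] -/
theorem cuGraph_not_adj_of_not_mem {L : ℕ} {u : Site d} (hu : u ∉ cuPts d L M Λ) (v : Site d) :
    ¬ (cuGraph d L M Λ).Adj u v :=
  regionGraph_not_adj_of_not_mem hu v

/-- The flat model: over the half-space Λ = {0 ≤ x_μ} the fine region is the parent's {x_μ < M} (any M). [folklore] -/
theorem cuFine_halfspace (M : ℕ) (μ : Fin d) : cuFine M {x : Site d | 0 ≤ x μ} = {x : Site d | x μ < M} := by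
  refine Set.ext fun x => ?_
  constructor
  · rintro ⟨w, hw, hxw⟩
    have hw' : ¬ 0 ≤ w μ := hw
    have h1 := (supDist_le_iff.1 hxw) μ
    show x μ < M
    omega
  · intro hx
    have hx' : x μ < M := hx
    refine ⟨Function.update x μ (x μ - M), fun hw => ?_, supDist_le_iff.2 fun i => ?_⟩
    · have hw' : 0 ≤ Function.update x μ (x μ - M) μ := hw
      rw [Function.update_self] at hw'
      omega
    · by_cases hi : i = μ
      · subst hi; rw [Function.update_self]; omega
      · rw [Function.update_of_ne hi]; simp

/-- … and the coarse region is the parent's half-lattice {0 ≤ y_μ} (L ≥ 1). [folklore] -/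
theorem cuCoarse_halfspace {L : ℕ} (hL : 0 < L) (μ : Fin d) : cuCoarse L {x : Site d | 0 ≤ x μ} = {y : Site d | 0 ≤ y μ} := by
  refine Set.ext fun y => ?_
  show 0 ≤ (L : ℤ) * y μ ↔ 0 ≤ y μ
  exact mul_nonneg_iff_of_pos_left (by exact_mod_cast hL)

/-- **The parent's flat two-scale model is the case Λ = {0 ≤ x_μ}** (L ≥ 1): equality of bond graphs. [folklore] -/
theorem cuGraph_halfspace {L : ℕ} (hL : 0 < L) (M : ℕ) (μ : Fin d) :
    cuGraph d L M {x : Site d | 0 ≤ x μ} = twoScaleGraph d L M μ := by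
  rw [cuGraph, cuFine_halfspace, cuCoarse_halfspace hL]
  exact regionGraph_flat d L M μ

/-- … with the same point set. [folklore] -/
theorem cuPts_halfspace {L : ℕ} (hL : 0 < L) (M : ℕ) (μ : Fin d) :
    cuPts d L M {x : Site d | 0 ≤ x μ} = twoScalePts d L M μ := by
  rw [cuPts, cuFine_halfspace, cuCoarse_halfspace hL]
  exact regionPts_flat d L M μ

/-- The salient corner: over the orthant Λ = `salientCoarse d I` the fine region is the first leaf's `salientFine d M I`
(some coordinate x_i < M, i ∈ I; any M). [folklore] -/
theorem cuFine_salientCoarse (M : ℕ) (I : Finset (Fin d)) : cuFine M (salientCoarse d I) = salientFine d M I := by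
  refine Set.ext fun x => ?_
  constructor
  · rintro ⟨w, hw, hxw⟩
    have hw' : ¬ ∀ i ∈ I, 0 ≤ w i := hw
    push Not at hw'
    obtain ⟨i, hi, hwi⟩ := hw'
    have h1 := (supDist_le_iff.1 hxw) i
    exact ⟨i, hi, by omega⟩
  · rintro ⟨i, hi, hxi⟩
    refine ⟨Function.update x i (x i - M), fun hw => ?_, supDist_le_iff.2 fun j => ?_⟩
    · have h1 : 0 ≤ Function.update x i (x i - M) i := hw i hi
      rw [Function.update_self] at h1
      omega
    · by_cases hj : j = i
      · subst hj; rw [Function.update_self]; omega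
      · rw [Function.update_of_ne hj]; simp

/-- … and the coarse region is the orthant itself (L ≥ 1). [folklore] -/
theorem cuCoarse_salientCoarse {L : ℕ} (hL : 0 < L) (I : Finset (Fin d)) :
    cuCoarse L (salientCoarse d I) = salientCoarse d I := by
  refine Set.ext fun y => ?_
  show (∀ i ∈ I, 0 ≤ (L : ℤ) * y i) ↔ ∀ i ∈ I, 0 ≤ y i
  exact forall₂_congr fun i _ => mul_nonneg_iff_of_pos_left (by exact_mod_cast hL)

/-- **The first leaf's salient corner model is the case Λ = ⋂_{i∈I}{0 ≤ x_i}** (L ≥ 1). [folklore] -/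
theorem cuGraph_salient {L : ℕ} (hL : 0 < L) (M : ℕ) (I : Finset (Fin d)) :
    cuGraph d L M (salientCoarse d I) = salientGraph d L M I := by
  rw [cuGraph, cuFine_salientCoarse, cuCoarse_salientCoarse hL]
  rfl

/-- … with the same point set. [folklore] -/
theorem cuPts_salient {L : ℕ} (hL : 0 < L) (M : ℕ) (I : Finset (Fin d)) :
    cuPts d L M (salientCoarse d I) = salientPts d L M I := by
  rw [cuPts, cuFine_salientCoarse, cuCoarse_salientCoarse hL]
  rfl

/-- The re-entrant corner: over the union of half-spaces Λ = `reentrantCoarse d I` the fine region is the first leaf's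
pocket `reentrantFine d M I` (all coordinates x_i < M, i ∈ I; any M). [folklore] -/
theorem cuFine_reentrantCoarse (M : ℕ) (I : Finset (Fin d)) :
    cuFine M (reentrantCoarse d I) = reentrantFine d M I := by
  refine Set.ext fun x => ?_
  constructor
  · rintro ⟨w, hw, hxw⟩ i hi
    have hw' : ¬ ∃ i ∈ I, 0 ≤ w i := hw
    push Not at hw'
    have h1 := hw' i hi
    have h2 := (supDist_le_iff.1 hxw) i
    show x i < M
    omega
  · intro hx
    have hx' : ∀ i ∈ I, x i < M := hx
    refine ⟨fun j => if j ∈ I then x j - M else x j, fun hw => ?_, supDist_le_iff.2 fun j => ?_⟩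
    · obtain ⟨i, hi, hwi⟩ := hw
      have h1 : (0 : ℤ) ≤ if i ∈ I then x i - M else x i := hwi
      rw [if_pos hi] at h1
      have h2 := hx' i hi
      omega
    · by_cases hj : j ∈ I
      · rw [if_pos hj]; omega
      · rw [if_neg hj]; simp

/-- … and the coarse region is the union of half-lattices itself (L ≥ 1). [folklore] -/
theorem cuCoarse_reentrantCoarse {L : ℕ} (hL : 0 < L) (I : Finset (Fin d)) :
    cuCoarse L (reentrantCoarse d I) = reentrantCoarse d I := by
  refine Set.ext fun y => ?_
  show (∃ i ∈ I, 0 ≤ (L : ℤ) * y i) ↔ ∃ i ∈ I, 0 ≤ y i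
  exact exists_congr fun i => and_congr_right fun _ => mul_nonneg_iff_of_pos_left (by exact_mod_cast hL)

/-- **The first leaf's re-entrant corner model is the case Λ = ⋃_{i∈I}{0 ≤ x_i}** (L ≥ 1). [folklore] -/
theorem cuGraph_reentrant {L : ℕ} (hL : 0 < L) (M : ℕ) (I : Finset (Fin d)) :
    cuGraph d L M (reentrantCoarse d I) = reentrantGraph d L M I := by
  rw [cuGraph, cuFine_reentrantCoarse, cuCoarse_reentrantCoarse hL]
  rfl

/-- … with the same point set. [folklore] -/
theorem cuPts_reentrant {L : ℕ} (hL : 0 < L) (M : ℕ) (I : Finset (Fin d)) :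
    cuPts d L M (reentrantCoarse d I) = reentrantPts d L M I := by
  rw [cuPts, cuFine_reentrantCoarse, cuCoarse_reentrantCoarse hL]
  rfl

/-! ### 11c. The coarse skeleton: consecutive Lη-points are joined at distance ≤ L for EVERY Λ [folklore] -/

variable {L : ℕ}

/-- An order box with sides ≤ M one of whose extreme corners lies outside Λ is part of the fine region. [folklore] -/
theorem Icc_subset_cuFine {lo hi : Site d} (hout : lo ∉ Λ ∨ hi ∉ Λ) (hside : ∀ i, hi i - lo i ≤ M) :
    Set.Icc lo hi ⊆ cuFine M Λ := by
  intro x hx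
  rw [Set.mem_Icc] at hx
  rcases hout with h | h
  · refine ⟨lo, h, supDist_le_iff.2 fun i => ?_⟩
    have h1 : lo i ≤ x i := hx.1 i
    have h2 : x i ≤ hi i := hx.2 i
    have h3 := hside i
    omega
  · refine ⟨hi, h, supDist_le_iff.2 fun i => ?_⟩
    have h1 : lo i ≤ x i := hx.1 i
    have h2 : x i ≤ hi i := hx.2 i
    have h3 := hside i
    omega

/-- **One step of the coarse skeleton** (1 ≤ L ≤ M, any Λ): L·z and L·(z + e_i) are joined at distance ≤ L — by the
coarse bond when both lie in Λ, and otherwise along the η-segment between them, whose L + 1 points lie within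
sup-distance L ≤ M of the end outside Λ, hence in the fine region, a chart. [folklore] -/
theorem cu_coarseStep (hL : 1 ≤ L) (hLM : L ≤ M) (Λ : Set (Site d)) (z : Site d) (i : Fin d) :
    (cuGraph d L M Λ).Reachable (scalePt L z) (scalePt L (z + Pi.single i 1)) ∧
      (cuGraph d L M Λ).dist (scalePt L z) (scalePt L (z + Pi.single i 1)) ≤ L := by
  have hadj : (zdGraph d).Adj z (z + Pi.single i 1) := (zdGraph_adj_iff _ _).2 ⟨i, Or.inl rfl⟩
  by_cases h : scalePt L z ∈ Λ ∧ scalePt L (z + Pi.single i 1) ∈ Λ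
  · have ha : (cuGraph d L M Λ).Adj (scalePt L z) (scalePt L (z + Pi.single i 1)) :=
      regionGraph_adj_of_coarse (by omega) hadj h.1 h.2
    exact ⟨ha.reachable, (dist_le_one_of_eq_or_adj (Or.inr ha)).trans hL⟩
  · have hcoord : ∀ j, scalePt L (z + Pi.single i 1) j = scalePt L z j + if j = i then (L : ℤ) else 0 := by
      intro j
      rw [scalePt_apply, scalePt_apply, Pi.add_apply]
      by_cases hj : j = i
      · subst hj; rw [Pi.single_eq_same, if_pos rfl]; ring
      · rw [Pi.single_eq_of_ne hj, if_neg hj]; ring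
    have hle' : ∀ j, scalePt L z j ≤ scalePt L (z + Pi.single i 1) j := fun j => by
      rw [hcoord j]; split_ifs <;> omega
    have hle : scalePt L z ≤ scalePt L (z + Pi.single i 1) := fun j => hle' j
    have hside : ∀ j, scalePt L (z + Pi.single i 1) j - scalePt L z j ≤ M := fun j => by
      rw [hcoord j]; split_ifs <;> omega
    have hout : scalePt L z ∉ Λ ∨ scalePt L (z + Pi.single i 1) ∉ Λ := by
      by_cases h1 : scalePt L z ∈ Λ
      · exact Or.inr fun h2 => h ⟨h1, h2⟩
      · exact Or.inl h1
    have hch := isBoxChart_region_fine (L := L) (C := cuCoarse L Λ) (cboxClosed_Icc _ _)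
      (Icc_subset_cuFine (M := M) (Λ := Λ) hout hside)
    have hlo := Set.left_mem_Icc.2 hle
    have hhi := Set.right_mem_Icc.2 hle
    have hr : (cuGraph d L M Λ).Reachable (scalePt L z) (scalePt L (z + Pi.single i 1)) :=
      reachable_of_chart hch hlo hhi
    have hd : (cuGraph d L M Λ).dist (scalePt L z) (scalePt L (z + Pi.single i 1)) ≤
        latL1Dist (scalePt L z) (scalePt L (z + Pi.single i 1)) := dist_le_latL1Dist_of_chart hch hlo hhi
    rw [latL1Dist_scalePt, latL1Dist_add_single, mul_one] at hd
    exact ⟨hr, hd⟩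

/-- **The coarse skeleton** (1 ≤ L ≤ M, any Λ): any two Lη-lattice points are joined, and
d(L·z, L·z′) ≤ L·‖z − z′‖₁ = ‖L·z − L·z′‖₁ — the coarse lattice is traversable at the adjacent-scale constant whether or
not its points lie in Λ. [folklore] -/
theorem cu_coarseLattice (hL : 1 ≤ L) (hLM : L ≤ M) (Λ : Set (Site d)) (z z' : Site d) :
    (cuGraph d L M Λ).Reachable (scalePt L z) (scalePt L z') ∧
      (cuGraph d L M Λ).dist (scalePt L z) (scalePt L z') ≤ L * latL1Dist z z' := by
  suffices key : ∀ (n : ℕ) (z : Site d), latL1Dist z z' ≤ n →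
      (cuGraph d L M Λ).Reachable (scalePt L z) (scalePt L z') ∧
        (cuGraph d L M Λ).dist (scalePt L z) (scalePt L z') ≤ L * latL1Dist z z' from key _ z le_rfl
  intro n
  induction n with
  | zero =>
    intro z hz
    have hzz : z = z' := eq_of_latL1Dist_eq_zero (Nat.le_zero.1 hz)
    subst hzz
    exact ⟨SimpleGraph.Reachable.refl _, by rw [SimpleGraph.dist_self]; exact Nat.zero_le _⟩
  | succ n ih =>
    intro z hz
    by_cases hzz : z = z'
    · subst hzz
      exact ⟨SimpleGraph.Reachable.refl _, by rw [SimpleGraph.dist_self]; exact Nat.zero_le _⟩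
    · obtain ⟨z₁, hadj, -, hlt⟩ := exists_step_towards hzz
      have h1 := latL1Dist_eq_one_of_adj hadj
      have htri := latL1Dist_triangle z z₁ z'
      obtain ⟨hr2, hd2⟩ := ih z₁ (by omega)
      have hstep : (cuGraph d L M Λ).Reachable (scalePt L z) (scalePt L z₁) ∧
          (cuGraph d L M Λ).dist (scalePt L z) (scalePt L z₁) ≤ L := by
        obtain ⟨i, hi | hi⟩ := (zdGraph_adj_iff z z₁).1 hadj
        · rw [hi]; exact cu_coarseStep hL hLM Λ z i
        · obtain ⟨hr, hd⟩ := cu_coarseStep hL hLM Λ z₁ i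
          rw [← hi, SimpleGraph.dist_comm] at hd
          rw [← hi] at hr
          exact ⟨hr.symm, hd⟩
      have h3 := hstep.1.dist_triangle_left (G := cuGraph d L M Λ) (scalePt L z')
      have h4 : L * latL1Dist z₁ z' + L ≤ L * latL1Dist z z' := by
        have h5 : latL1Dist z₁ z' + 1 ≤ latL1Dist z z' := hlt
        calc L * latL1Dist z₁ z' + L = L * (latL1Dist z₁ z' + 1) := by ring
          _ ≤ L * latL1Dist z z' := Nat.mul_le_mul_left L h5
      have h6 := hstep.2
      exact ⟨hstep.1.trans hr2, by omega⟩

/-! ### 11d. The anchor: a fine point reaches an Lη-point at cost ≤ d(L − 1) through the hull of a cube outside Λ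
[folklore] -/

/-- **The anchor** (1 ≤ L ≤ M, Λ a cube union): a fine point u — within sup-distance M of some w ∉ Λ, hence of the whole
cube Q ∋ w of the partition, Q ∩ Λ = ∅ — lies in the order box H = hull(u, Q) ⊆ `cuFine` (each point of H is within
sup-distance M of its clamp into Q), a fine chart each of whose sides is ≥ M ≥ L; rounding each coordinate of u inside H
to a multiple of L gives an Lη-point L·z ∈ H with |u_i − L·z_i| ≤ L − 1, so d(u, L·z) ≤ ‖u − L·z‖₁ ≤ d(L − 1). [folklore] -/
theorem exists_anchor (hL : 1 ≤ L) (hLM : L ≤ M) (hΛ : IsCubeUnion M Λ) {u : Site d} (hu : u ∈ cuFine M Λ) :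
    ∃ z : Site d, (cuGraph d L M Λ).Reachable u (scalePt L z) ∧
      (cuGraph d L M Λ).dist u (scalePt L z) ≤ latL1Dist u (scalePt L z) ∧
      latL1Dist u (scalePt L z) ≤ d * (L - 1) := by
  have hL0 : (0 : ℤ) < L := by exact_mod_cast (show 0 < L by omega)
  have hM : 0 < M := by omega
  obtain ⟨w, hwΛ, huw⟩ := hu
  -- the cube Q = box b of the partition containing w misses Λ
  have hwQ := mem_blockBox_blockIdx hM w
  generalize blockIdx M w = b at hwQ
  have hQ : ∀ p ∈ (blockAtlas d M).box b, p ∉ Λ := fun p hp hpΛ => hwΛ (hΛ hp hpΛ hwQ)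
  have hwi : ∀ i, (M : ℤ) * b i ≤ w i ∧ w i ≤ (M : ℤ) * b i + ((M : ℤ) - 1) := mem_blockBox_iff.1 hwQ
  have huwi : ∀ i, (u i - w i).natAbs ≤ M := supDist_le_iff.1 huw
  -- the hull H = Icc lo hi of u and Q
  obtain ⟨lo, hlo⟩ : ∃ lo : Site d, ∀ i, lo i = min (u i) ((M : ℤ) * b i) := ⟨_, fun _ => rfl⟩
  obtain ⟨hi, hhi⟩ : ∃ hi : Site d, ∀ i, hi i = max (u i) ((M : ℤ) * b i + ((M : ℤ) - 1)) := ⟨_, fun _ => rfl⟩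
  have hH : Set.Icc lo hi ⊆ cuFine M Λ := by
    intro x hx
    rw [Set.mem_Icc] at hx
    -- the clamp p of x into Q
    obtain ⟨p, hp⟩ : ∃ p : Site d, ∀ i, p i = max ((M : ℤ) * b i) (min (x i) ((M : ℤ) * b i + ((M : ℤ) - 1))) :=
      ⟨_, fun _ => rfl⟩
    have hpQ : p ∈ (blockAtlas d M).box b := by
      rw [mem_blockBox_iff]
      intro i
      have h0 := hp i
      constructor <;> omega
    refine ⟨p, hQ p hpQ, supDist_le_iff.2 fun i => ?_⟩
    have h1 : lo i ≤ x i := hx.1 i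
    have h2 : x i ≤ hi i := hx.2 i
    have h3 := hwi i
    have h4 := huwi i
    have h5 := hlo i
    have h6 := hhi i
    have h7 := hp i
    omega
  have hch := isBoxChart_region_fine (L := L) (C := cuCoarse L Λ) (cboxClosed_Icc lo hi) hH
  have huH : u ∈ Set.Icc lo hi :=
    Set.mem_Icc.2 ⟨fun i => by rw [hlo i]; exact min_le_left _ _, fun i => by rw [hhi i]; exact le_max_left _ _⟩
  -- the rounded point L·z ∈ H
  obtain ⟨z, hz⟩ : ∃ z : Site d, ∀ i, z i = if lo i ≤ (L : ℤ) * (u i / L) then u i / L else u i / L + 1 :=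
    ⟨_, fun _ => rfl⟩
  have hzi : ∀ i, lo i ≤ (L : ℤ) * z i ∧ (L : ℤ) * z i ≤ hi i ∧ (u i - (L : ℤ) * z i).natAbs ≤ L - 1 := by
    intro i
    have h1 := Int.mul_ediv_add_emod (u i) (L : ℤ)
    have h2 := Int.emod_nonneg (u i) hL0.ne'
    have h3 := Int.emod_lt_of_pos (u i) hL0
    have h4 := hwi i
    have h5 := huwi i
    have h6 := hlo i
    have h7 := hhi i
    rw [hz i]
    split_ifs with h
    · refine ⟨h, ?_, ?_⟩ <;> omega
    · rw [mul_add, mul_one]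
      refine ⟨?_, ?_, ?_⟩ <;> omega
  have hzH : scalePt L z ∈ Set.Icc lo hi :=
    Set.mem_Icc.2 ⟨fun i => by rw [scalePt_apply]; exact (hzi i).1, fun i => by rw [scalePt_apply]; exact (hzi i).2.1⟩
  have hdist : latL1Dist u (scalePt L z) ≤ d * (L - 1) := by
    unfold latL1Dist
    calc ∑ i, (u i - scalePt L z i).natAbs ≤ ∑ _i : Fin d, (L - 1) :=
          Finset.sum_le_sum fun i _ => by rw [scalePt_apply]; exact (hzi i).2.2
      _ = d * (L - 1) := by simp
  have hr : (cuGraph d L M Λ).Reachable u (scalePt L z) := reachable_of_chart hch huH hzH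
  have hd : (cuGraph d L M Λ).dist u (scalePt L z) ≤ latL1Dist u (scalePt L z) :=
    dist_le_latL1Dist_of_chart hch huH hzH
  exact ⟨z, hr, hd, hdist⟩

/-! ### 11e. The comparison over an arbitrary cube union: additive constant 4d(L − 1) [folklore] -/

/-- Fine–coarse over a cube union (1 ≤ L ≤ M): d(u, L·y) ≤ ‖u − L·y‖₁ + 2d(L − 1) for u fine and ANY y ∈ ℤ^d — the
anchor L·z of u, then the coarse skeleton from L·z to L·y (‖L·z − L·y‖₁ ≤ ‖L·z − u‖₁ + ‖u − L·y‖₁). [folklore] -/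
theorem cu_fine_coarse (hL : 1 ≤ L) (hLM : L ≤ M) (hΛ : IsCubeUnion M Λ) {u : Site d} (hu : u ∈ cuFine M Λ)
    (y : Site d) :
    (cuGraph d L M Λ).Reachable u (scalePt L y) ∧
      (cuGraph d L M Λ).dist u (scalePt L y) ≤ latL1Dist u (scalePt L y) + 2 * (d * (L - 1)) := by
  obtain ⟨z, hr1, hd1, hz⟩ := exists_anchor hL hLM hΛ hu
  obtain ⟨hr2, hd2⟩ := cu_coarseLattice hL hLM Λ z y
  have h3 := hr1.dist_triangle_left (G := cuGraph d L M Λ) (scalePt L y)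
  have h4 := latL1Dist_triangle (scalePt L z) u (scalePt L y)
  have h5 : L * latL1Dist z y = latL1Dist (scalePt L z) (scalePt L y) := (latL1Dist_scalePt L z y).symm
  have h6 := latL1Dist_comm u (scalePt L z)
  exact ⟨hr1.trans hr2, by omega⟩

/-- Fine–fine over a cube union (1 ≤ L ≤ M): d(u, v) ≤ ‖u − v‖₁ + 4d(L − 1) — through the anchor of u and the
fine–coarse route of v to it. [folklore] -/
theorem cu_fine_fine (hL : 1 ≤ L) (hLM : L ≤ M) (hΛ : IsCubeUnion M Λ) {u v : Site d} (hu : u ∈ cuFine M Λ)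
    (hv : v ∈ cuFine M Λ) :
    (cuGraph d L M Λ).Reachable u v ∧ (cuGraph d L M Λ).dist u v ≤ latL1Dist u v + 4 * (d * (L - 1)) := by
  obtain ⟨z, hr1, hd1, hz⟩ := exists_anchor hL hLM hΛ hu
  obtain ⟨hr2, hd2⟩ := cu_fine_coarse hL hLM hΛ hv z
  have h3 := hr1.dist_triangle_left (G := cuGraph d L M Λ) v
  have h4 := latL1Dist_triangle v u (scalePt L z)
  have h5 := latL1Dist_comm u v
  have h6 : (cuGraph d L M Λ).dist (scalePt L z) v = (cuGraph d L M Λ).dist v (scalePt L z) :=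
    SimpleGraph.dist_comm
  exact ⟨hr1.trans hr2.symm, by omega⟩

/-- **The comparison over an ARBITRARY UNION OF CUBES** (1 ≤ L ≤ M, Λ any cube union of the M-partition): all points
u, v of the model are joined by an admissible walk — input (α) — and `dist u v ≤ ‖u − v‖₁ + 4·(d·(L − 1))` in η-units:
the comparison of the parent's §8e item 8 (flat: L − 1) and of the first leaf's §10 (corners: m(L − 1)) with an
additive constant depending on d and L only, the same for every domain Ω and every M ≥ L. [folklore] -/
theorem cu_reachable_dist (hL : 1 ≤ L) (hLM : L ≤ M) (hΛ : IsCubeUnion M Λ) {u v : Site d}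
    (hu : u ∈ cuPts d L M Λ) (hv : v ∈ cuPts d L M Λ) :
    (cuGraph d L M Λ).Reachable u v ∧ (cuGraph d L M Λ).dist u v ≤ latL1Dist u v + 4 * (d * (L - 1)) := by
  rcases hu with hu | ⟨y, -, rfl⟩ <;> rcases hv with hv | ⟨y', -, rfl⟩
  · exact cu_fine_fine hL hLM hΛ hu hv
  · obtain ⟨hr, h⟩ := cu_fine_coarse hL hLM hΛ hu y'
    exact ⟨hr, by omega⟩
  · obtain ⟨hr, h⟩ := cu_fine_coarse hL hLM hΛ hv y
    rw [SimpleGraph.dist_comm, latL1Dist_comm] at h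
    exact ⟨hr.symm, by omega⟩
  · obtain ⟨hr, h⟩ := cu_coarseLattice hL hLM Λ y y'
    refine ⟨hr, h.trans ?_⟩
    rw [latL1Dist_scalePt]
    omega

/-! ### 11f. The exponential transfer and the last «≤» of (2.66) over an arbitrary cube union [folklore] -/

/-- The (2.66)-shaped exponential form over a cube union: e^{−δ‖u − v‖₁} ≤ e^{δ·4d(L−1)}·e^{−δ·dist(u,v)} on the point
set (δ ≥ 0; 1 ≤ L ≤ M) — a factor depending on d, L, δ only. [folklore] -/
theorem cu_exp_decay_le (hL : 1 ≤ L) (hLM : L ≤ M) (hΛ : IsCubeUnion M Λ) {δ : ℝ} (hδ : 0 ≤ δ) {u v : Site d}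
    (hu : u ∈ cuPts d L M Λ) (hv : v ∈ cuPts d L M Λ) :
    Real.exp (-(δ * latL1Dist u v)) ≤
      Real.exp (δ * (4 * (d * ((L : ℝ) - 1)))) * Real.exp (-(δ * (cuGraph d L M Λ).dist u v)) := by
  have h := (cu_reachable_dist hL hLM hΛ hu hv).2
  have hL1 : ((L - 1 : ℕ) : ℝ) = (L : ℝ) - 1 := by rw [Nat.cast_sub hL, Nat.cast_one]
  have hK : ((4 * (d * (L - 1)) : ℕ) : ℝ) = 4 * (d * ((L : ℝ) - 1)) := by rw [← hL1]; norm_cast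
  have h' : ((cuGraph d L M Λ).dist u v : ℝ) ≤ 1 * (latL1Dist u v : ℝ) + 4 * (d * ((L : ℝ) - 1)) := by
    rw [one_mul, ← hK]
    exact_mod_cast h
  simpa using exp_decay_transfer hδ one_pos h'

/-- **The last «≤» of (2.66) over an ARBITRARY UNION OF CUBES** (δ₀ > 0; 1 ≤ L ≤ M; y ∈ T, finite S ⊆ T; scale-correct
weights as in the parent's §9c): Σ_{y″∈S} e^{−δ₀‖y − y″‖₁}·e^{−½δ₀·d(y″,y′)} ≤ e^{½δ₀·4d(L−1)}·c₀(δ₀, ½)^d·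
e^{−½δ₀·d(y,y′)} — the constant depends on d, L, δ₀ only: UNIFORM IN M (the dependence p. 247 prints for the O(1) of
Prop. 2.6) AND IN THE DOMAIN Λ. [folklore] -/
theorem cu_sum266_le (hL : 1 ≤ L) (hLM : L ≤ M) (hΛ : IsCubeUnion M Λ) {δ₀ : ℝ} (hδ : 0 < δ₀) {y : Site d}
    (hy : y ∈ cuPts d L M Λ) (y' : Site d) (S : Finset (Site d)) (hS : ∀ y'' ∈ S, y'' ∈ cuPts d L M Λ) :
    ∑ y'' ∈ S, Real.exp (-(δ₀ * (latL1Dist y y'' : ℝ))) *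
        Real.exp (-(δ₀ / 2 * ((cuGraph d L M Λ).dist y'' y' : ℝ))) ≤
      Real.exp (δ₀ / 2 * (4 * (d * ((L : ℝ) - 1)))) * B6.c0 δ₀ (1 / 2) ^ d *
        Real.exp (-(δ₀ / 2 * ((cuGraph d L M Λ).dist y y' : ℝ))) := by
  have hL1 : ((L - 1 : ℕ) : ℝ) = (L : ℝ) - 1 := by rw [Nat.cast_sub hL, Nat.cast_one]
  have hK : ((4 * (d * (L - 1)) : ℕ) : ℝ) = 4 * (d * ((L : ℝ) - 1)) := by rw [← hL1]; norm_cast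
  rw [← hK]
  exact sum266_le_of_cmp hδ y' S (fun y'' hy'' => (cu_reachable_dist hL hLM hΛ hy (hS y'' hy'')).1)
    (fun y'' hy'' => (cu_reachable_dist hL hLM hΛ hy (hS y'' hy'')).2)

/-! ### 11g. No uniform additive constant below d(L − 1) [folklore] -/

/-- The re-entrant corner witness of the first leaf, read in the cube-union model: over Λ = ⋃_{i∈I}{0 ≤ x_i}
(M = L·M′, M′ ≥ 1, L ≥ 1, I ≠ ∅) the fine point (M − 1)·𝟙_I and the coarse point M·𝟙_I are at distance EXACTLY
‖u − v‖₁ + |I|·(L − 1). [folklore] -/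
theorem cu_constant_attained {M' : ℕ} (hL : 1 ≤ L) (hM' : 0 < M') (hM : M = L * M') {I : Finset (Fin d)}
    (hI : I.Nonempty) :
    (cuGraph d L M (reentrantCoarse d I)).dist (cornerFinePt I M) (scalePt L (cornerCoarseIdx I M')) =
      latL1Dist (cornerFinePt I M) (scalePt L (cornerCoarseIdx I M')) + I.card * (L - 1) := by
  rw [cuGraph_reentrant (by omega) M I]
  obtain ⟨h1, h2⟩ := reentrant_dist_cornerWitness (d := d) (I := I) hL hM' hM hI
  rw [h1, h2]
  have h3 : L = (L - 1) + 1 := by omega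
  conv_lhs => rw [h3]
  ring

/-- **No additive constant below d(L − 1) is uniform in the domain**: for every M = L·M′ (M′ ≥ 1, L ≥ 1) and d ≥ 1 there
is a cube union Λ (the union of the d coordinate half-spaces) with two model points at distance exactly
‖u − v‖₁ + d(L − 1).  The sharp uniform constant thus lies between d(L − 1) and the 4d(L − 1) of `cu_reachable_dist`;
it is not determined here. [folklore] -/
theorem cu_constant_lower {M' : ℕ} (hL : 1 ≤ L) (hM' : 0 < M') (hM : M = L * M') (hd : 0 < d) :
    ∃ Λ : Set (Site d), IsCubeUnion M Λ ∧ ∃ u ∈ cuPts d L M Λ, ∃ v ∈ cuPts d L M Λ,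
      (cuGraph d L M Λ).dist u v = latL1Dist u v + d * (L - 1) := by
  have hne : (Finset.univ : Finset (Fin d)).Nonempty := @Finset.univ_nonempty _ _ ⟨⟨0, hd⟩⟩
  refine ⟨reentrantCoarse d Finset.univ, isCubeUnion_reentrantCoarse M _, cornerFinePt Finset.univ M, ?_,
    scalePt L (cornerCoarseIdx Finset.univ M'), scalePt_mem_cuPts L M _ _, ?_⟩
  · rw [cuPts_reentrant (by omega) M Finset.univ]
    exact Or.inl cornerFinePt_mem
  · rw [cu_constant_attained hL hM' hM hne, Finset.card_univ, Fintype.card_fin]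

end CubeUnion

end Literature.MathematicalPhysics.QuantumFieldTheory.Balaban1983to89.B6BoxChartsCubeUnions
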